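import Summits.NavierStokesRegularity.NavierStokesRegularity.Theorems.AveragedTypeIBlowup.Negative.NSReduction
import Summits.NavierStokesRegularity.NavierStokesRegularity.Theorems.PerpetualPumpThesisBesovFloorBoundEmbed

/-!
# Stubs K2 / K1 of line `SketchIdeator2` for `PerpetualPump.Thesis`: tightness

Support file for the line `SketchIdeator2` (idea `besov-envelope-floor`) of the crux
stmt-NavierStokesRegularity-1832, `PerpetualPump.Thesis` (abstract Type-I exclusion over Tao's
averaging class, T. Tao, J. Amer. Math. Soc. 29 (2016), §1.1). The line reduces `Thesis` to the
(landed) abstract Leray floor in the Besov envelope `Ḃ⁰_{∞,1}` together with the two open stubs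

* K2 `stub_envelopeUpgrade`: a Type-I bound `‖u(t)‖_∞ ≤ M/√(T-t)` along an `H¹⁰_df`-mild solution
  forces a Type-I bound of the envelope amplitude `√(T-t)‖u(t)‖_{Ḃ⁰_{∞,1}} ≤ M'`;
* K1 `stub_noPersistentFront`: the envelope amplitude cannot stay pinched in `[ε, M']` on `[0,T)`.

This file certifies that both stubs are NECESSARY: each is implied by `Thesis` itself
(`stub_envelopeUpgrade_Tight`, `stub_noPersistentFront_Tight`), so that, modulo the landed floor,
the line is an exact reformulation of the crux. The mechanism is the `H¹⁰` continuity of a mild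
extension at `T` (`extension_H10_bounded`: an extendable solution is `H¹⁰`-bounded on `[0,T)`)
combined with the embedding `H¹⁰ ⊂ Ḃ⁰_{∞,1}` (`F.exists_eHomBesovNorm_le_H10`): the envelope of an
extendable solution is bounded, so its amplitude is `O(√(T-t)) → 0`, which is both a Type-I
envelope bound (K2) and incompatible with a pinching from below (K1); for K1 the `L^∞` Type-I rate
fed to `Thesis` comes from the upper pinch through `Ḃ⁰_{∞,1} ⊂ L^∞`
(`F.eLpNorm_le_eHomBesovNorm_L2C`).

## References

* T. Tao, J. Amer. Math. Soc. 29 (2016), 601–674, arXiv:1402.0290, §1.1 (1.15), p. 8.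
* H. Bahouri, J.-Y. Chemin, R. Danchin, *Fourier Analysis and Nonlinear PDE* (2011), §2.1.
-/

noncomputable section

open MeasureTheory Set Filter Topology
open scoped ENNReal NNReal SchwartzMap

set_option linter.dupNamespace false

namespace Summit.NavierStokesRegularity.NavierStokesRegularity.Theorems.PerpetualPumpThesis.K2

open Literature.Analysis.FluidPDE Literature.Analysis.FluidPDE.Tao2016
open Literature.Analysis.FunctionSpaces
open Summit.NavierStokesRegularity.NavierStokesRegularity.Theses.PerpetualPump
open Summit.NavierStokesRegularity.NavierStokesRegularity.Theorems.AveragedTypeIBlowup.Negative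

/-! ### Envelope of an `H¹⁰`-bounded curve -/

/-- **`H¹⁰` bound ⇒ envelope bound.** If `‖u(t)‖_{H¹⁰} ≤ C` on `[0,T)` then
`‖u(t)‖_{Ḃ⁰_{∞,1}} ≤ K` on `[0,T)` for some `K ≥ 0` (namely `C_F · max C 0`, with `C_F` the
constant of the embedding `H¹⁰ ⊂ Ḃ⁰_{∞,1}` on `L²(ℝ³; ℂ³)`). -/
theorem exists_besov_le_of_H10_bound {T : ℝ} {u : ℝ → L2C} {C : ℝ}
    (hC : ∀ t ∈ Ico 0 T, eFourierSobolevNorm 10 (u t) ≤ ENNReal.ofReal C) :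
    ∃ K : ℝ, 0 ≤ K ∧ ∀ t ∈ Ico 0 T,
      eHomBesovNorm 0 ∞ 1
          ((u t : L2C) : 𝓢'(EuclideanSpace ℝ (Fin 3), EuclideanSpace ℂ (Fin 3))) ≤
        ENNReal.ofReal K := by
  obtain ⟨CF, hCF⟩ := F.exists_eHomBesovNorm_le_H10
  refine ⟨CF * max C 0, mul_nonneg CF.coe_nonneg (le_max_right _ _), fun t ht => ?_⟩
  rw [ENNReal.ofReal_mul CF.coe_nonneg, ENNReal.ofReal_coe_nnreal]
  calc eHomBesovNorm 0 ∞ 1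
        ((u t : L2C) : 𝓢'(EuclideanSpace ℝ (Fin 3), EuclideanSpace ℂ (Fin 3)))
      ≤ CF * eFourierSobolevNorm 10 (u t) := hCF (u t)
    _ ≤ CF * ENNReal.ofReal (max C 0) := by
        gcongr
        exact (hC t ht).trans (ENNReal.ofReal_le_ofReal (le_max_left _ _))

/-- **Envelope bound ⇒ Type-I envelope amplitude bound.** If `‖u(t)‖_{Ḃ⁰_{∞,1}} ≤ K` on `[0,T)`
then `√(T-t) ‖u(t)‖_{Ḃ⁰_{∞,1}} ≤ √T · K` on `[0,T)`. -/
theorem envAmp_le_of_besov_le {T : ℝ} {u : ℝ → L2C} {K : ℝ}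
    (hB : ∀ t ∈ Ico 0 T,
      eHomBesovNorm 0 ∞ 1
          ((u t : L2C) : 𝓢'(EuclideanSpace ℝ (Fin 3), EuclideanSpace ℂ (Fin 3))) ≤
        ENNReal.ofReal K) :
    ∀ t ∈ Ico 0 T, ENNReal.ofReal (Real.sqrt (T - t)) *
      eHomBesovNorm 0 ∞ 1
          ((u t : L2C) : 𝓢'(EuclideanSpace ℝ (Fin 3), EuclideanSpace ℂ (Fin 3))) ≤
        ENNReal.ofReal (Real.sqrt T * K) := by
  intro t ht
  have hsqrt : Real.sqrt (T - t) ≤ Real.sqrt T := Real.sqrt_le_sqrt (by linarith [ht.1])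
  rw [ENNReal.ofReal_mul (Real.sqrt_nonneg T)]
  exact mul_le_mul' (ENNReal.ofReal_le_ofReal hsqrt) (hB t ht)

/-- **Pointwise envelope amplitude bound, real form.** If `√(T-t) ‖u(t)‖_{Ḃ⁰_{∞,1}} ≥ ε > 0` and
`‖u(t)‖_{Ḃ⁰_{∞,1}} ≤ K` at some `t`, then `ε ≤ √(T-t) · K`. -/
theorem le_sqrt_mul_of_pinch {T t ε K : ℝ} {u : ℝ → L2C} (hε : 0 < ε)
    (hlow : ENNReal.ofReal ε ≤ ENNReal.ofReal (Real.sqrt (T - t)) *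
      eHomBesovNorm 0 ∞ 1
        ((u t : L2C) : 𝓢'(EuclideanSpace ℝ (Fin 3), EuclideanSpace ℂ (Fin 3))))
    (hB : eHomBesovNorm 0 ∞ 1
        ((u t : L2C) : 𝓢'(EuclideanSpace ℝ (Fin 3), EuclideanSpace ℂ (Fin 3))) ≤
      ENNReal.ofReal K) :
    ε ≤ Real.sqrt (T - t) * K := by
  have h : ENNReal.ofReal ε ≤ ENNReal.ofReal (Real.sqrt (T - t) * K) := by
    rw [ENNReal.ofReal_mul (Real.sqrt_nonneg _)]
    exact hlow.trans (mul_le_mul' le_rfl hB)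
  rcases ENNReal.ofReal_le_ofReal_iff'.1 h with h' | h'
  · exact h'
  · exact absurd h' (not_le.mpr hε)

/-- **The amplitude weight `√(T-t)` becomes small near `T`.** For `0 < ε`, `0 < T` and any real
`K` there is `t ∈ [0,T)` with `√(T-t) · K < ε` (take `T - t = min T (ε/L)²`, `L = max K 0 + 1`). -/
theorem exists_sqrt_mul_lt {ε T : ℝ} (hε : 0 < ε) (hT : 0 < T) (K : ℝ) :
    ∃ t ∈ Ico 0 T, Real.sqrt (T - t) * K < ε := by
  set L : ℝ := max K 0 + 1 with hL
  have hL0 : 0 < L := by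
    have := le_max_right K 0
    linarith
  have hKL : K < L := by
    have := le_max_left K 0
    linarith
  set δ : ℝ := min T ((ε / L) ^ 2) with hδ
  have hδ0 : 0 < δ := lt_min hT (pow_pos (div_pos hε hL0) 2)
  have hδT : δ ≤ T := min_le_left _ _
  refine ⟨T - δ, ⟨by linarith, by linarith⟩, ?_⟩
  have hTt : T - (T - δ) = δ := by ring
  rw [hTt]
  have hsq : Real.sqrt δ ≤ ε / L := by
    calc Real.sqrt δ ≤ Real.sqrt ((ε / L) ^ 2) := Real.sqrt_le_sqrt (min_le_right _ _)
      _ = ε / L := Real.sqrt_sq (div_pos hε hL0).le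
  have hsqpos : 0 < Real.sqrt δ := Real.sqrt_pos.2 hδ0
  calc Real.sqrt δ * K < Real.sqrt δ * L := mul_lt_mul_of_pos_left hKL hsqpos
    _ ≤ ε / L * L := mul_le_mul_of_nonneg_right hsq hL0.le
    _ = ε := div_mul_cancel₀ ε hL0.ne'

/-! ### The `L^∞` Type-I rate from the upper pinch -/

/-- **Upper pinch ⇒ `L^∞` Type-I rate.** If `√(T-t) ‖u(t)‖_{Ḃ⁰_{∞,1}} ≤ M'` at some `t < T` then
`‖u(t)‖_{L^∞} ≤ M'/√(T-t)`, by `Ḃ⁰_{∞,1} ⊂ L^∞` on `L²(ℝ³; ℂ³)`. -/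
theorem eLpNorm_le_of_envAmp_le {T t M' : ℝ} {u : ℝ → L2C} (ht : t < T)
    (hup : ENNReal.ofReal (Real.sqrt (T - t)) *
      eHomBesovNorm 0 ∞ 1
        ((u t : L2C) : 𝓢'(EuclideanSpace ℝ (Fin 3), EuclideanSpace ℂ (Fin 3))) ≤
      ENNReal.ofReal M') :
    eLpNorm (u t) ⊤ volume ≤ ENNReal.ofReal (M' / Real.sqrt (T - t)) := by
  have hpos : 0 < Real.sqrt (T - t) := Real.sqrt_pos.2 (by linarith)
  have hne : ENNReal.ofReal (Real.sqrt (T - t)) ≠ 0 := by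
    rwa [Ne, ENNReal.ofReal_eq_zero, not_le]
  rw [ENNReal.ofReal_div_of_pos hpos]
  refine (F.eLpNorm_le_eHomBesovNorm_L2C (u t)).trans ?_
  rw [ENNReal.le_div_iff_mul_le (Or.inl hne) (Or.inl ENNReal.ofReal_ne_top), mul_comm]
  exact hup

/-! ### `Thesis` bounds the `H¹⁰` norm of a Type-I solution -/

/-- **`Thesis` ⇒ `H¹⁰`-boundedness of Type-I solutions.** Under `Thesis`, an `H¹⁰_df`-mild
solution of a symmetric cancelling averaged equation from Schwartz divergence-free data with the
`L^∞` Type-I rate on `[0,T)` extends past `T`, hence (`extension_H10_bounded`) its `H¹⁰` norm is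
bounded on `[0,T)`. -/
theorem exists_H10_bound_of_thesis (hTh : Thesis) (𝒜 : AveragingDatum) (hs : 𝒜.IsSymmetric)
    (hc : 𝒜.HasCancellation) (u₀ : 𝓢(EuclideanSpace ℝ (Fin 3), EuclideanSpace ℝ (Fin 3)))
    (hdiv : VectorCalculus.IsDivFree ⇑u₀) (T : ℝ) (hT : 0 < T) (u : ℝ → L2C)
    (hu : 𝒜.IsMildSolution (schwartzL2 u₀) (Ico 0 T) u)
    (hrate : ∃ M : ℝ, ∀ t ∈ Ico 0 T,
      eLpNorm (u t) ⊤ volume ≤ ENNReal.ofReal (M / Real.sqrt (T - t))) :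
    ∃ C : ℝ, ∀ t ∈ Ico 0 T, eFourierSobolevNorm 10 (u t) ≤ ENNReal.ofReal C := by
  obtain ⟨T', hTT', v, hv, huv⟩ := hTh 𝒜 hs hc u₀ hdiv T hT u hu hrate
  exact extension_H10_bounded hTT' hv huv

end Summit.NavierStokesRegularity.NavierStokesRegularity.Theorems.PerpetualPumpThesis.K2

namespace Summit.NavierStokesRegularity.NavierStokesRegularity.Theorems.PerpetualPumpThesis

open Literature.Analysis.FluidPDE Literature.Analysis.FluidPDE.Tao2016
open Literature.Analysis.FunctionSpaces

/-- **Tightness of stub K2 (registered sub-goal `stub_envelopeUpgrade_Tight`)**: `Thesis` implies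
the envelope upgrade `stub_envelopeUpgrade`. Given `Thesis`, a Type-I solution extends past `T`,
so it is `H¹⁰`-bounded on `[0,T)` (`extension_H10_bounded`), so its envelope is bounded
(`H¹⁰ ⊂ Ḃ⁰_{∞,1}`) and its envelope amplitude is at most `√T · C_F · C`. -/
theorem stub_envelopeUpgrade_Tight : Summit.NavierStokesRegularity.NavierStokesRegularity.Theses.PerpetualPump.Thesis → ∀ 𝒜 : AveragingDatum, 𝒜.IsSymmetric → 𝒜.HasCancellation → ∀ u₀ : 𝓢(EuclideanSpace ℝ (Fin 3), EuclideanSpace ℝ (Fin 3)), VectorCalculus.IsDivFree ⇑u₀ → ∀ T : ℝ, 0 < T → ∀ u : ℝ → L2C, 𝒜.IsMildSolution (schwartzL2 u₀) (Ico 0 T) u → (∃ M : ℝ, ∀ t ∈ Ico 0 T, eLpNorm (u t) ⊤ volume ≤ ENNReal.ofReal (M / Real.sqrt (T - t))) → ∃ M' : ℝ, ∀ t ∈ Ico 0 T, ENNReal.ofReal (Real.sqrt (T - t)) * eHomBesovNorm 0 ⊤ 1 ((u t : L2C) : 𝓢'(EuclideanSpace ℝ (Fin 3), EuclideanSpace ℂ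 (Fin 3))) ≤ ENNReal.ofReal M' := by
  intro hTh 𝒜 hs hc u₀ hdiv T hT u hu hrate
  obtain ⟨C, hC⟩ := K2.exists_H10_bound_of_thesis hTh 𝒜 hs hc u₀ hdiv T hT u hu hrate
  obtain ⟨K, -, hK⟩ := K2.exists_besov_le_of_H10_bound hC
  exact ⟨Real.sqrt T * K, K2.envAmp_le_of_besov_le hK⟩

/-- **Tightness of stub K1 (registered sub-goal `stub_noPersistentFront_Tight`)**: `Thesis` implies
the no-persistent-front statement `stub_noPersistentFront`. Given a pinching
`ε ≤ √(T-t)‖u(t)‖_{Ḃ⁰_{∞,1}} ≤ M'` on `[0,T)`, the upper pinch and `Ḃ⁰_{∞,1} ⊂ L^∞` give the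
`L^∞` Type-I rate `‖u(t)‖_∞ ≤ M'/√(T-t)`; `Thesis` then extends `u` past `T`, so `u` is
`H¹⁰`-bounded, so its envelope is bounded by some `K`, and the lower pinch `ε ≤ √(T-t) K` fails for
`t` close to `T`. -/
theorem stub_noPersistentFront_Tight : Summit.NavierStokesRegularity.NavierStokesRegularity.Theses.PerpetualPump.Thesis → ∀ 𝒜 : AveragingDatum, 𝒜.IsSymmetric → 𝒜.HasCancellation → ∀ u₀ : 𝓢(EuclideanSpace ℝ (Fin 3), EuclideanSpace ℝ (Fin 3)), VectorCalculus.IsDivFree ⇑u₀ → ∀ T : ℝ, 0 < T → ∀ u : ℝ → L2C, 𝒜.IsMildSolution (schwartzL2 u₀) (Ico 0 T) u → ∀ ε M' : ℝ, 0 < ε → (∀ t ∈ Ico 0 T, ENNReal.ofReal ε ≤ ENNReal.ofReal (Real.sqrt (T - t)) * eHomBesovNorm 0 ⊤ 1 ((u t : L2C) : 𝓢'(EuclideanSpace ℝ (Fin 3), EuclideanSpace ℂ (Fin 3))) ∧ ENNReal.ofReal (Real.sqrt (T - t)) * eHomBesovNorm 0 ⊤ 1 ((u t : L2C) : 𝓢'(EuclideanSpace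 ℝ (Fin 3), EuclideanSpace ℂ (Fin 3))) ≤ ENNReal.ofReal M') → False := by
  intro hTh 𝒜 hs hc u₀ hdiv T hT u hu ε M' hε hpinch
  have hrate : ∃ M : ℝ, ∀ t ∈ Ico 0 T,
      eLpNorm (u t) ⊤ volume ≤ ENNReal.ofReal (M / Real.sqrt (T - t)) :=
    ⟨M', fun t ht => K2.eLpNorm_le_of_envAmp_le ht.2 (hpinch t ht).2⟩
  obtain ⟨C, hC⟩ := K2.exists_H10_bound_of_thesis hTh 𝒜 hs hc u₀ hdiv T hT u hu hrate
  obtain ⟨K, -, hK⟩ := K2.exists_besov_le_of_H10_bound hC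
  obtain ⟨t, ht, hlt⟩ := K2.exists_sqrt_mul_lt hε hT K
  exact absurd (K2.le_sqrt_mul_of_pinch hε (hpinch t ht).1 (hK t ht)) (not_le.mpr hlt)

end Summit.NavierStokesRegularity.NavierStokesRegularity.Theorems.PerpetualPumpThesis

end
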